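import Summits.QuantumFields.YangMills.Theorems.BalabanUVNodesN16PinnedLooseMatchSqueezeClassRadius
import Summits.QuantumFields.YangMills.Theorems.BalabanUVNodesN16ProducersAtBareLedgerReading

/-!
# Route «BalabanUVNodes», crux K3⁸ `SpineGivenEndpointR13SepCoPHV` (stmt-QuantumFields-27366), node N16 = NE3: THE (β16) PRODUCER WITH THE N16 → N19′ JUNCTION ROWS —
# module 50's squeeze with the radius letter ENLARGED so that the slot key's loose leaf meets dag-n16-w4's junction rows; the junction `hH3 ∧ hsel` from `h5` + slot key +
# node N07's two sentences only (module 53)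

Cell `pub-ymgap`, seat `pub-ymgap-dag-n16-e` (R134 acceleration seat (a), strategy s2 = BY-NAME KNIT at the record; HUMAN RULING D-0062; chair R424 venue), generation 18,
module 53 (THEOREMS ONLY, 0 `def`, 0 `sorry`, standard axioms).  `--kind proof --supports stmt-QuantumFields-27366 --as helper` (count-neutral; proves NO registered stub).
`bears_on: R4∕N16 · edges N05 → N16, N07 → N16 · junction N16 → N19′ (stub 2) · composite N27`.

WHY.  dag-n16-w4's junction knits `…N16ProducersAtBareLedgerReading` (p640452) §2∕§4∕§5 and `…Generic` (p641547), and dag-n27-c's composite storeys APB16ᴮ∕AWB16ⱽ, DISPLAY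
— besides node N07's two sentences ((P)-(8) at `(ρ F, εTop F)`, Theorem 1 sentence 2 for interior local minimisers) — SIX rows that are node N16's LETTER BOOKKEEPING: a radius
`ρ F` and a gradient letter `c F`, a loose leaf `hloose : LeafH3sup 4 F.L Nper (ρ F) (ρ F) (c F) D_F` on the pinned loose data `D_F = {V ∈ ne3DomOfRecord₁₁ F N 0 0 | V ∈ sfClass
… ((ℓ₃ F).ε ∕ B F) 0}`, and the scalar rows `hρε : ρ F ≤ (ℓ₃ F).ε`, `hρb : ρ F ≤ (ℓ₃ F).b`, `hc : c F ≤ c' F`.  The loose leaf IS in the tree from the SLOT KEY — dag-n16-w1's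
`…N16H7LooseOfReg910Slot.leafH3sup_loose_of_reg910Slot` gives `LeafH3sup 4 L Nper ρ ρ (16937·ρ) {V ∈ dom | V ∈ sfClass … (ρ∕B₃) 0}` for `0 < ρ ≤ min(B₃a₁, 1∕28)` — so at
the pinned radius `ε∕B` one must take `ρ F := (C F).B₃·((ℓ₃ F).ε ∕ B F)` and `c F := 16937·ρ F`; the scalar rows then read `B₃ ≤ B`, `B₃·ε∕B ≤ b`, `16937·B₃·ε∕B ≤ c'`,
`ε∕B ≤ a₁`, `28·B₃·ε ≤ B`.  Module 49∕50's radius letter `B := max B₃ (4ε∕c')` (with `b := c'`) meets the first but not the others.  Every module-49 row is ANTITONE in `B`,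
so this module re-runs module 50's construction with the radius letter ENLARGED to
`B′ F := max (max B₃ (4ε∕c')) (max (16937·B₃·ε∕c') (max (ε∕a₁) (28·B₃·ε)))` (same `ℓ₃`, same `c' := min (ε∕(2^76·L^12)) (1∕(2^91·L^17))`, same `b := c'`), and exports the
loose leaf and the junction scalar rows as two more conjuncts.  PRICE (stated, not hidden): the pinned data radius is now `ε∕B′ ≤ c'∕(16937·B₃)` — near-flat data, a factor
`16937·B₃∕4` below module 49's `ε∕B ≤ c'∕4`; modules 47∕49∕50∕52 and their consumers are untouched (this is a NEW producer, not an edition).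

WHAT IS PROVED ([folklore] real arithmetic + by-name application; [Balaban1985Variational] Thm 1 (9)–(10) p. 279 is the DISPLAYED slot key, asserted for nothing).
§1 `junctionRows_of_lowerBounds` — scalars only: ANY `B′` above the five lower bounds `B₃`, `4ε∕c'`, `16937·B₃·ε∕c'`, `ε∕a₁`, `28·B₃·ε` (with `0 < c'`, `2^91·L^17·c' ≤ 1`,
`2^76·L^12·c' ≤ ε`) meets module 49 §2's B-rows (`0 < B′`, `B₃ ≤ B′`, `ε∕B′ ≤ c'`, `ε∕B′ ≤ 1∕4`, `4(ε∕B′) ≤ c'`, `2^78·L^12 ≤ B′`) AND the junction rows at `ρ := B₃·(ε∕B′)`: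
`0 < ρ`, `ρ ≤ ε`, `ρ ≤ c'`, `16937·ρ ≤ c'`, `ρ ≤ B₃·a₁`, `ρ ≤ 1∕28`.
§2 ★★ `exists_letters_n16HolderAtReading_loose_squeezeJunction_of_h5_reg910Slot` — module 50's ★ `…_loose_squeezeFull_of_h5_reg910Slot` (SAME binders: node N05's `h5`
VERBATIM, a local-gauge shape `G F` monotone in its radii with the (9)_{β₀=1} interface, constants `C F`, the SLOT KEY `hR`; SAME first five conjuncts: `N16LettersEnd`, the
MATCH row, `B₃ ≤ B ∧ floor`, node N19′'s ten-row N16-letter block at `t := c' F`, `∀ 𝔯, N16PinnedLoose 𝔯 ℓ₃ B → N16HolderAtReading 𝔯 β`) at the enlarged radius letter,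
PLUS (6th) the loose leaf `∀ F, LeafH3sup 4 F.L Nper (ρ F) (ρ F) (16937·ρ F) D_F` at `ρ F := (C F).B₃·((ℓ₃ F).ε ∕ B F)` and (7th) the rows `0 < ρ F`, `ρ F ≤ (ℓ₃ F).ε`,
`ρ F ≤ (ℓ₃ F).b`, `16937·ρ F ≤ c' F`, `ρ F ≤ (C F).B₃·(C F).a₁`, `ρ F ≤ 1∕28` — p640452 §2's `hloose ∕ hρε ∕ hρb ∕ hc` PRODUCED (with `c F := 16937·ρ F`).
§3 ★★ `exists_letters_hH3_hsel_of_h5_reg910Slot_of_exists8P_locMin` — THE N16 → N19′ JUNCTION from `h5` + the slot key + node N07's two sentences ONLY: §2's letters and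
first five conjuncts, then, for every top radius `εTop` with `(ℓ₃ F).ε ≤ εTop F`, every (P)-(8) at `(ρ F, εTop F)` and every sentence-2-for-interior-local-minimisers at
`εTop F` (p640452 §2's binder texts VERBATIM at the produced `ρ`), and every reading pinned loose at `(ℓ₃, B)`: the per-tuple rows `hH3` (`LeafH3sup 4 R.ne3.L R.ne3.Nper
R.ne3.ε R.ne3.b (c' F) R.ne3.dom`) and `hsel` (selected `R.ne3.ε`-minimisers, `RegularSup … R.ne3.b (c' F)`) of dag-n19-w3's (5)∕(5b) at `R := rateCarriersOfRecord₁₃CoPH 𝔯 F θ hP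
g₀ os k` — p640452 §2's two theorems fed by §2 here.  After it a junction bill keyed on this producer displays NO N16 letter row.

DEPENDENCES (by name): module 50 (`exists_letters_inEndRegimeH_leafSlotHolderAT_classRadius_of_h5_reg910Slot`); module 49 (`leafSlotHolderAT_reletter`,
`inEndRegimeH_reletter`, `squeezeLetters_spec`); module 45 (`n16HolderAt_anti_dom`, `looseDom_anti`); module 43 (`N16PinnedLoose`, `N16LettersEnd`, `N16HolderAtReading`,
`n16HolderAtReading_of_pinnedLoose`); `…N16LeafSlotAllTorus.n16HolderAt_of_inEndRegimeH_leafSlotHolderAT`; `…N16.gradConst_four_pos`; dag-n16-w1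
`…N16H7LooseOfReg910Slot.leafH3sup_loose_of_reg910Slot` (p609800); dag-n16-w4 `…N16ProducersAtBareLedgerReading.hH3_of_pinnedLoose_of_loose_of_exists8P_locMin` ∕
`hsel_of_pinnedLoose_of_loose_of_exists8P` (p640452); Mathlib (`div_le_iff₀`, `le_div_iff₀`, `div_le_div_of_nonneg_left`, `mul_div_cancel_left₀`).

HONEST FRAMING.  Bookkeeping BY NAME plus real-arithmetic rows; no estimate.  `h5` (node N05), the slot key (node N07 = [Balaban1985Variational] Thm 1 (9)–(10) on the
collar-slot cubes), (P)-(8) and sentence 2 (node N07) are DISPLAYED hypotheses asserted for no family; nothing of Bałaban is asserted or refuted; no stub of K3⁸ v6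
(`stub_rates13HV` ∕ `stub_expansion13HV`) is closed or claimed; N16 ∕ N05 ∕ N07 ∕ N19 ∕ N27 NOT discharged; counts UNMOVED (typed 28∕28 · discharged 5∕27 · A 5∕28).  One
finite four-torus at fixed `ε`, Bałaban AS PRINTED — NOT ℝ⁴, NOT infinite volume, NOT OS, NOT a mass gap; the YM mass gap (Clay) is NOT proved by any of this — R4 closes the
conditional finite-𝕋⁴ rung `BalabanLadder.UV` only; no summit statement is proved by this seat.

Reference: [Balaban1985Variational] T. Bałaban, *The variational problem and background fields in renormalization group method for lattice gauge theories*, CMP **102** (1985)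
277–309, Thm 1 p. 279.
-/

set_option autoImplicit false

open scoped BigOperators Matrix Matrix.Norms.L2Operator
open NormedSpace

namespace Summit.QuantumFields.YangMills.BalabanUVNodes.N16PinnedLooseMatchSqueezeJunction

open Literature.MathematicalPhysics.QuantumFieldTheory.Balaban1983to89
open Literature.MathematicalPhysics.QuantumFieldTheory.Balaban1983to89.T4Continuum (T4Family ULoop)
open B7Prop1Explicit B7Prop2Explicit MatrixLog UnitaryModel
open T4AveragingDeficitWall hiding Site Plane Plaq Bond
open B7Prop3Flat (c3)
open B8LeafModelZd (ZdIdx)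
open B8LeafModelZd3 (zdGF3)
open Node00 (Stage13HParams NE3Objects₁₁ NE3Letters₁₁ ne3ConstLayerOfRecord₁₁ ne3NperOfRecord₁₁ ne3DomOfRecord₁₁ MatA)
open Summit.QuantumFields.BalabanUV.T4Continuum
open MinimalActionSandwich (IsMinimiser admissible)
open MinimalActionLevels (levelAction)
open MinimalActionRate (sfClass)
open MinimalActionRefine (RegularSup gradConst)
open MinimalActionDictionary (torusVP RadiiMono)
open NE3.LeafIndexSockets (LeafH3sup)
open NE3EnergyShapes (IsUnitarySite IsPeriodicSite)
open AveragingDeficitLatticeH2Prep (fd)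
open B11 (Regularity)
open YMDAG.UVSplit (ne3OfRecord₁₁ RateReading₁₃CoPH rateCarriersOfRecord₁₃CoPH)
open Summit.QuantumFields.YangMills.BalabanUVNodes.N16HolderRegime (InEndRegimeH radiusOfRecordH constOfRecordH)
open Summit.QuantumFields.YangMills.BalabanUVNodes.N16LeafSlotAllTorus (LeafSlotHolderAT n16HolderAt_of_inEndRegimeH_leafSlotHolderAT)
open Summit.QuantumFields.YangMills.BalabanUVNodes.N16H7LooseOfReg910Slot (leafH3sup_loose_of_reg910Slot)
open Summit.QuantumFields.YangMills.BalabanUVNodes.N16PinnedLayer13CoPH (N16PinnedLoose N16LettersEnd N16HolderAtReading n16HolderAtReading_of_pinnedLoose)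
open Summit.QuantumFields.YangMills.BalabanUVNodes.N16PinnedLooseMatch (n16HolderAt_anti_dom looseDom_anti)
open Summit.QuantumFields.YangMills.BalabanUVNodes.N16 (gradConst_four_pos)
open Summit.QuantumFields.YangMills.BalabanUVNodes.N16PinnedLooseMatchSqueeze (leafSlotHolderAT_reletter inEndRegimeH_reletter squeezeLetters_spec)
open Summit.QuantumFields.YangMills.BalabanUVNodes.N16PinnedLooseMatchSqueezeClassRadius
  (exists_letters_inEndRegimeH_leafSlotHolderAT_classRadius_of_h5_reg910Slot)
open Summit.QuantumFields.YangMills.BalabanUVNodes.N16ProducersAtBareLedgerReading (hH3_of_pinnedLoose_of_loose_of_exists8P_locMin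
  hsel_of_pinnedLoose_of_loose_of_exists8P)

noncomputable section

variable {N : ℕ} [NeZero N] {β : ℝ}

/-! ## §1 Scalars: any radius letter above five lower bounds meets module 49's B-rows and the junction rows at `ρ := B₃·(ε∕B′)` -/

/-- **THE ENLARGED RADIUS LETTER MEETS EVERY ROW** (`1 ≤ L`, `0 < ε`, `0 < B₃`, `0 < a₁`, `0 < c'`, the radii rows `2^91·L^17·c' ≤ 1`, `2^76·L^12·c' ≤ ε`, and a letter `B′`
with `B₃ ≤ B′`, `4ε∕c' ≤ B′`, `16937·B₃·ε∕c' ≤ B′`, `ε∕a₁ ≤ B′`, `28·B₃·ε ≤ B′`): module 49 §2's B-rows `0 < B′`, `B₃ ≤ B′`, `ε∕B′ ≤ c'`, `ε∕B′ ≤ 1∕4`, `4·(ε∕B′) ≤ c'`,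
`2^78·L^12 ≤ B′`, and the JUNCTION rows at the loose-leaf radius `ρ := B₃·(ε∕B′)`: `0 < ρ`, `ρ ≤ ε`, `ρ ≤ c'`, `16937·ρ ≤ c'`, `ρ ≤ B₃·a₁`, `ρ ≤ 1∕28`. [folklore] -/
theorem junctionRows_of_lowerBounds {L ε B₃ a₁ c' B' : ℝ} (hL : 1 ≤ L) (hε : 0 < ε) (hB₃ : 0 < B₃) (ha₁ : 0 < a₁) (hc' : 0 < c')
    (h17 : (2 : ℝ) ^ 91 * L ^ 17 * c' ≤ 1) (h12 : (2 : ℝ) ^ 76 * L ^ 12 * c' ≤ ε)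
    (h1 : B₃ ≤ B') (h2 : 4 * ε / c' ≤ B') (h3 : 16937 * B₃ * ε / c' ≤ B') (h4 : ε / a₁ ≤ B') (h5 : 28 * B₃ * ε ≤ B') :
    (0 < B' ∧ B₃ ≤ B' ∧ ε / B' ≤ c' ∧ ε / B' ≤ 1 / 4 ∧ 4 * (ε / B') ≤ c' ∧ (2 : ℝ) ^ 78 * L ^ 12 ≤ B') ∧
    (0 < B₃ * (ε / B') ∧ B₃ * (ε / B') ≤ ε ∧ B₃ * (ε / B') ≤ c' ∧ 16937 * (B₃ * (ε / B')) ≤ c' ∧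
      B₃ * (ε / B') ≤ B₃ * a₁ ∧ B₃ * (ε / B') ≤ 1 / 28) := by
  have hB' : 0 < B' := lt_of_lt_of_le hB₃ h1
  have hB'ne : B' ≠ 0 := hB'.ne'
  have hεne : ε ≠ 0 := hε.ne'
  have hL17 : (1 : ℝ) ≤ L ^ 17 := one_le_pow₀ hL
  have hq0 : 0 ≤ ε / B' := (div_pos hε hB').le
  -- `c' ≤ 1`
  have hc'1 : c' ≤ 1 := by
    have h1' : (1 : ℝ) ≤ (2 : ℝ) ^ 91 * L ^ 17 := by nlinarith
    have : 1 * c' ≤ (2 : ℝ) ^ 91 * L ^ 17 * c' := mul_le_mul_of_nonneg_right h1' hc'.le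
    linarith
  -- `4·(ε∕B′) ≤ c'`
  have h2' : 4 * ε ≤ B' * c' := (div_le_iff₀ hc').mp h2
  have hq : 4 * (ε / B') ≤ c' := by
    rw [← mul_div_assoc, div_le_iff₀ hB']
    linarith [mul_comm B' c']
  -- `16937·ρ ≤ c'`
  have hρ0 : 0 < B₃ * (ε / B') := mul_pos hB₃ (div_pos hε hB')
  have h16 : 16937 * (B₃ * (ε / B')) ≤ c' := by
    have h3' : 16937 * B₃ * ε ≤ B' * c' := (div_le_iff₀ hc').mp h3
    rw [show 16937 * (B₃ * (ε / B')) = (16937 * B₃ * ε) / B' by ring, div_le_iff₀ hB']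
    linarith [mul_comm B' c']
  refine ⟨⟨hB', h1, by linarith, by linarith, hq, ?_⟩, ⟨hρ0, ?_, le_trans (le_mul_of_one_le_left hρ0.le (by norm_num)) h16, h16, ?_, ?_⟩⟩
  · -- the floor: `2^78·L^12 = 4·(2^76·L^12) ≤ 4·(ε∕c') = 4ε∕c' ≤ B′`
    have h12' : (2 : ℝ) ^ 76 * L ^ 12 ≤ ε / c' := by rw [le_div_iff₀ hc']; exact h12
    calc (2 : ℝ) ^ 78 * L ^ 12 = 4 * ((2 : ℝ) ^ 76 * L ^ 12) := by ring
      _ ≤ 4 * (ε / c') := by linarith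
      _ = 4 * ε / c' := (mul_div_assoc _ _ _).symm
      _ ≤ B' := h2
  · -- `ρ ≤ ε`
    calc B₃ * (ε / B') ≤ B' * (ε / B') := mul_le_mul_of_nonneg_right h1 hq0
      _ = ε := by field_simp
  · -- `ρ ≤ B₃·a₁`
    have hqa : ε / B' ≤ a₁ := by
      calc ε / B' ≤ ε / (ε / a₁) := div_le_div_of_nonneg_left hε.le (div_pos hε ha₁) h4
        _ = a₁ := by rw [div_div_eq_mul_div, mul_div_cancel_left₀ a₁ hεne]
    exact mul_le_mul_of_nonneg_left hqa hB₃.le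
  · -- `ρ ≤ 1∕28`
    rw [show B₃ * (ε / B') = (B₃ * ε) / B' by ring, div_le_iff₀ hB']
    linarith

/-! ## §2 ★★ The producer with the junction rows: module 50's construction at the enlarged radius letter, plus the loose leaf from the slot key -/

section Producer

variable (hβ0 : 0 ≤ β) (hβ1 : β ≤ 1)
include hβ0 hβ1

/-- **★★ THE PRODUCER OF THE THREE N16 CONJUNCTS WITH NODE N19′'s COMPLETE N16-LETTER BLOCK AND THE N16 → N19′ JUNCTION ROWS** — from node N05's `h5`, a local-gauge shape
`G F` monotone in its radii with the (9)_{β₀=1} interface, constants `C F`, and the SLOT KEY `hR` (module 47∕49∕50's binders): letters `ℓ₃` (module 49's: `(ℓ₃ F).b := c' F`,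
`(ℓ₃ F).g := gradConst 4 (c' F)`), the sup letter `c' F := min (ε∕(2^76·L^12)) (1∕(2^91·L^17))`, and the ENLARGED radius letter
`B F := max (max (C F).B₃ (4ε∕c' F)) (max (16937·(C F).B₃·ε∕c' F) (max (ε∕(C F).a₁) (28·(C F).B₃·ε)))` (`ε := (ℓ₃ F).ε`), with: `N16LettersEnd N (gradConst 4 ∘ c') ℓ₃`; the
MATCH row; `(C F).B₃ ≤ B F ∧ 2^78·L^12 ≤ B F`; node N19′'s ten-row N16-letter block (module 50's, VERBATIM); the N16 conjunct at every reading pinned loose at `ℓ₃, B`; the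
LOOSE LEAF `LeafH3sup 4 F.L Nper (ρ F) (ρ F) (16937·ρ F) D_F` at `ρ F := (C F).B₃·((ℓ₃ F).ε ∕ B F)` on the pinned loose data (dag-n16-w1's `leafH3sup_loose_of_reg910Slot` at
`ε := ρ F`, whose data cut `ρ F ∕ (C F).B₃` IS `(ℓ₃ F).ε ∕ B F`); and the junction scalar rows `0 < ρ F`, `ρ F ≤ (ℓ₃ F).ε`, `ρ F ≤ (ℓ₃ F).b`, `16937·ρ F ≤ c' F`,
`ρ F ≤ (C F).B₃·(C F).a₁`, `ρ F ≤ 1∕28`. [cite: Balaban1985Variational, Thm 1 (9)–(10) p.279] [folklore] -/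
theorem exists_letters_n16HolderAtReading_loose_squeezeJunction_of_h5_reg910Slot
    (h5 : ∀ F : T4Family, letI : CStarAlgebra (Matrix (Fin N) (Fin N) ℂ) := {}
      ∃ (len : Site 4 → ℝ) (c₁ c₁' B₁' cP C₂ B₀β : ℝ) (inp : B8.B9Inputs),
        (∀ v : Site 4, 0 < len v → 1 ≤ len v) ∧ (∀ μ : Fin 4, len (e μ) = 1) ∧ 0 < B₁' ∧ 5 * ((4 : ℕ) : ℝ) * F.L * inp.B₀ ≤ B₁' ∧ 0 < c₁' ∧
        (∀ α₀ α₁ : ℝ, 0 < α₀ → 0 < α₁ → α₀ + α₁ ≤ c₁' →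
          α₀ + α₁ ≤ c₁ ∧ C0 4 * (2 * α₀) ≤ 1 / 3 ∧ 4 * α₀ ≤ c2' 4 F.L ∧ 16 * (B₁' * (α₀ + α₁)) ≤ 1 ∧
          Real.exp (4 * (800 * (((4 : ℕ) : ℝ) + 1) ^ 2 * (((4 : ℕ) : ℝ) + 4)) * α₀) * (1 + 8 * (131072 * (((4 : ℕ) : ℝ) + 1) ^ 2) * (B₁' * (α₀ + α₁))) ≤ 2 ∧
          2 * (B₁' * (α₀ + α₁)) ≤ c3 4 F.L ∧ ((4 : ℕ) : ℝ) * F.L * α₁ ≤ 1 / 8 ∧ α₀ ≤ cP ∧ α₁ ≤ cP ∧ B₁' * (α₀ + α₁) ≤ cP ∧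
          2 * (B₁' * (α₀ + α₁)) ^ 2 + 20 * ((4 : ℕ) : ℝ) * α₀ * (B₁' * (α₀ + α₁)) + 2 * C₂ * (B₁' * (α₀ + α₁)) ^ 2 ≤ α₀ + α₁) ∧
        B8.Thm4Body c₁ B₁' (fun i : {i : ZdIdx 4 F.L // (∀ j, i.Ω j = Set.univ) ∧ (∀ m j, i.Λs m j = {_y | j = m}) ∧ (∀ m j, i.Λb m j = {_c | j = m}) ∧ i.η = ((F.L : ℝ)⁻¹) ^ i.k} => (zdGF3 (Matrix (Fin N) (Fin N) ℂ) F.L β len i.1).toGFData) ∧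
        B8.Prop3Body cP 4 (F.L : ℝ) C₂ inp B₀β (fun i : {i : ZdIdx 4 F.L // (∀ j, i.Ω j = Set.univ) ∧ (∀ m j, i.Λs m j = {_y | j = m}) ∧ (∀ m j, i.Λb m j = {_c | j = m}) ∧ i.η = ((F.L : ℝ)⁻¹) ^ i.k} => (zdGF3 (Matrix (Fin N) (Fin N) ℂ) F.L β len i.1).toGFData2))
    {G : T4Family → (Site 4 → Fin 4 → (MatA N)ˣ) → Site 4 → ℕ → ℝ → ℝ → ℝ → Prop} (hGm : ∀ F, RadiiMono 4 (G F))
    (hG : ∀ (F : T4Family) (U : Site 4 → Fin 4 → (MatA N)ˣ) (x : Site 4) (K : ℕ) (α₀ α₁ α₂ : ℝ), 2 ≤ K → G F U x K α₀ α₁ α₂ →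
      ∃ (u : Site 4 → (MatA N)ˣ) (a : Site 4 → Fin 4 → MatA N),
        (∀ z, u z ∈ unitaryUnits (MatA N)) ∧
        (∀ (y : Site 4) (τ : Fin 4), l1 (y - x) ≤ 2 → ((gaugeAct u U y τ : (MatA N)ˣ) : MatA N) = exp (a y τ)) ∧
        (∀ (y : Site 4) (τ : Fin 4), l1 (y - x) ≤ 2 → ‖a y τ‖ ≤ α₀) ∧
        (∀ (y : Site 4) (τ i : Fin 4), l1 (y - x) ≤ 1 → ‖fd i (fun z => a z τ) y‖ ≤ α₁) ∧
        (∀ (τ i l : Fin 4), ‖fd i (fd l (fun z => a z τ)) x‖ ≤ α₂))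
    (C : T4Family → B11Thm1.Consts)
    (hR : ∀ (F : T4Family) (k : ℕ) (ε₁ : ℝ), 0 < ε₁ → ε₁ ≤ (C F).a₁ → ∀ (V U : Site 4 → Fin 4 → (MatA N)ˣ), V ∈ sfClass 4 F.L (ne3NperOfRecord₁₁ F 0 0) ε₁ 0 →
      IsMinimiser 4 (sfClass 4 F.L (ne3NperOfRecord₁₁ F 0 0) ((C F).B₃ * ε₁)) F.L (ne3NperOfRecord₁₁ F 0 0) (k + 1) V U →
        ∀ x : Site 4, Regularity (torusVP 4 F.L (ne3NperOfRecord₁₁ F 0 0) (G F) (k + 1)) (C F).B₃ (C F).B₄ ε₁ U (x, F.L ^ (k + 1) - 1 + F.L ^ (k + 1) + 2)) :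
    ∃ (ℓ₃ : T4Family → NE3Letters₁₁) (B c' : T4Family → ℝ), N16LettersEnd N (fun F => gradConst 4 (c' F)) ℓ₃ ∧
      (∀ F : T4Family, 0 < B F ∧ (ℓ₃ F).ε / B F ≤ (ℓ₃ F).b) ∧
      (∀ F : T4Family, (C F).B₃ ≤ B F ∧ (2 : ℝ) ^ 78 * (F.L : ℝ) ^ 12 ≤ B F) ∧
      (∀ F : T4Family, (ℓ₃ F).g = gradConst 4 (c' F) ∧ 0 ≤ c' F ∧ 0 < c' F ∧ (ℓ₃ F).b ≤ c' F ∧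
        (2 : ℝ) ^ 91 * (F.L : ℝ) ^ 17 * c' F ≤ 1 ∧ (2 : ℝ) ^ 76 * (F.L : ℝ) ^ 12 * c' F ≤ (ℓ₃ F).ε ∧
        16 * C0 4 * (ℓ₃ F).ε ≤ 3 ∧ 1024 * (4 + 1) * (4 + 4) * (F.L : ℝ) ^ 2 * (ℓ₃ F).ε ≤ 1 ∧
        (ℓ₃ F).ε / B F ≤ 1 / 4 ∧ 4 * ((ℓ₃ F).ε / B F) ≤ c' F) ∧
      (∀ 𝔯 : RateReading₁₃CoPH N, N16PinnedLoose 𝔯 ℓ₃ B → N16HolderAtReading 𝔯 β) ∧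
      (∀ F : T4Family, LeafH3sup 4 F.L (ne3NperOfRecord₁₁ F 0 0) ((C F).B₃ * ((ℓ₃ F).ε / B F)) ((C F).B₃ * ((ℓ₃ F).ε / B F))
        (16937 * ((C F).B₃ * ((ℓ₃ F).ε / B F)))
        ({V | V ∈ ne3DomOfRecord₁₁ F N 0 0 ∧ V ∈ sfClass 4 F.L (ne3NperOfRecord₁₁ F 0 0) ((ℓ₃ F).ε / B F) 0} : Set (Site 4 → Fin 4 → (MatA N)ˣ))) ∧
      (∀ F : T4Family, 0 < (C F).B₃ * ((ℓ₃ F).ε / B F) ∧ (C F).B₃ * ((ℓ₃ F).ε / B F) ≤ (ℓ₃ F).ε ∧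
        (C F).B₃ * ((ℓ₃ F).ε / B F) ≤ (ℓ₃ F).b ∧ 16937 * ((C F).B₃ * ((ℓ₃ F).ε / B F)) ≤ c' F ∧
        (C F).B₃ * ((ℓ₃ F).ε / B F) ≤ (C F).B₃ * (C F).a₁ ∧ (C F).B₃ * ((ℓ₃ F).ε / B F) ≤ 1 / 28) := by
  -- the letters of record at the loose object of radius `ε ∕ B₃`, from `h5` and the slot key, at the auxiliary coupling letter `1`, with the class-radius rows (module 50 §2)
  choose ℓ hℓ using fun F => exists_letters_inEndRegimeH_leafSlotHolderAT_classRadius_of_h5_reg910Slot (N := N) F one_pos (h5 F) (hGm F) (hG F) (C F) (hR F)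
  have hε0 : ∀ F, 0 < (ℓ F).ε := fun F => (hℓ F).2.2.2.2.2.2.2.2.1.2.2.2.1
  have hL1 : ∀ F : T4Family, (1 : ℝ) ≤ F.L := fun F => by exact_mod_cast le_trans one_le_two (HistoryFlow.two_le_L F)
  have hL1n : ∀ F : T4Family, 1 ≤ F.L := fun F => le_trans one_le_two (HistoryFlow.two_le_L F)
  -- the squeezed sup letter per family (module 49) and the ENLARGED radius letter
  obtain ⟨c'f, hc'f⟩ : ∃ c'f : T4Family → ℝ, c'f = fun F => min ((ℓ F).ε / ((2 : ℝ) ^ 76 * (F.L : ℝ) ^ 12)) (1 / ((2 : ℝ) ^ 91 * (F.L : ℝ) ^ 17)) := ⟨_, rfl⟩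
  have hs : ∀ F, 0 < c'f F ∧ (2 : ℝ) ^ 91 * (F.L : ℝ) ^ 17 * c'f F ≤ 1 ∧ (2 : ℝ) ^ 76 * (F.L : ℝ) ^ 12 * c'f F ≤ (ℓ F).ε ∧ c'f F ≤ (ℓ F).ε / 2 ∧
      512 * (4 + 1) * (4 + 4) * (F.L : ℝ) ^ 2 * c'f F ≤ 1 := fun F => by
    subst hc'f
    obtain ⟨h1, h2, h3, h4, h5', -⟩ := squeezeLetters_spec (hL1 F) (hε0 F) (C F).B₃_pos
    exact ⟨h1, h2, h3, h4, h5'⟩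
  obtain ⟨Bf, hBf⟩ : ∃ Bf : T4Family → ℝ, Bf = fun F => max (max (C F).B₃ (4 * (ℓ F).ε / c'f F))
      (max (16937 * (C F).B₃ * (ℓ F).ε / c'f F) (max ((ℓ F).ε / (C F).a₁) (28 * (C F).B₃ * (ℓ F).ε))) := ⟨_, rfl⟩
  have hJ : ∀ F, (0 < Bf F ∧ (C F).B₃ ≤ Bf F ∧ (ℓ F).ε / Bf F ≤ c'f F ∧ (ℓ F).ε / Bf F ≤ 1 / 4 ∧ 4 * ((ℓ F).ε / Bf F) ≤ c'f F ∧
      (2 : ℝ) ^ 78 * (F.L : ℝ) ^ 12 ≤ Bf F) ∧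
      (0 < (C F).B₃ * ((ℓ F).ε / Bf F) ∧ (C F).B₃ * ((ℓ F).ε / Bf F) ≤ (ℓ F).ε ∧ (C F).B₃ * ((ℓ F).ε / Bf F) ≤ c'f F ∧
        16937 * ((C F).B₃ * ((ℓ F).ε / Bf F)) ≤ c'f F ∧ (C F).B₃ * ((ℓ F).ε / Bf F) ≤ (C F).B₃ * (C F).a₁ ∧ (C F).B₃ * ((ℓ F).ε / Bf F) ≤ 1 / 28) := fun F => by
    subst hBf
    exact junctionRows_of_lowerBounds (hL1 F) (hε0 F) (C F).B₃_pos (C F).a₁_pos (hs F).1 (hs F).2.1 (hs F).2.2.1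
      (le_max_of_le_left (le_max_left _ _)) (le_max_of_le_left (le_max_right _ _)) (le_max_of_le_right (le_max_left _ _))
      (le_max_of_le_right (le_max_of_le_right (le_max_left _ _))) (le_max_of_le_right (le_max_of_le_right (le_max_right _ _)))
  -- the loose leaf from the slot key at `ρ := B₃·(ε∕B)` (its data cut `ρ∕B₃` is the pinned loose radius `ε∕B`)
  have hleaf : ∀ F : T4Family, LeafH3sup 4 F.L (ne3NperOfRecord₁₁ F 0 0) ((C F).B₃ * ((ℓ F).ε / Bf F)) ((C F).B₃ * ((ℓ F).ε / Bf F))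
      (16937 * ((C F).B₃ * ((ℓ F).ε / Bf F)))
      ({V | V ∈ ne3DomOfRecord₁₁ F N 0 0 ∧ V ∈ sfClass 4 F.L (ne3NperOfRecord₁₁ F 0 0) ((ℓ F).ε / Bf F) 0} : Set (Site 4 → Fin 4 → (MatA N)ˣ)) := fun F => by
    have hl := leafH3sup_loose_of_reg910Slot (hL1n F) (hGm F) (hG F) (C F) (hR F) (hJ F).2.1 (hJ F).2.2.2.2.2.1 (hJ F).2.2.2.2.2.2
      (ne3DomOfRecord₁₁ F N 0 0)
    rwa [mul_div_cancel_left₀ _ (C F).B₃_pos.ne'] at hl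
  refine ⟨fun F => ⟨(ℓ F).ε, c'f F, gradConst 4 (c'f F), constOfRecordH N F.L (ne3NperOfRecord₁₁ F 0 0) (gradConst 4 (c'f F)), (ℓ F).Λ₁, (ℓ F).Λ₂'⟩, Bf, c'f,
    fun F => ⟨rfl, (hℓ F).2.1, rfl, (hs F).1, (hs F).2.2.2.2, (hℓ F).2.2.2.2.2.1, ?_⟩,
    fun F => ⟨(hJ F).1.1, (hJ F).1.2.2.1⟩, fun F => ⟨(hJ F).1.2.1, (hJ F).1.2.2.2.2.2⟩,
    fun F => ⟨rfl, (hs F).1.le, (hs F).1, le_rfl, (hs F).2.1, (hs F).2.2.1, (hℓ F).2.2.2.2.2.2.1, (hℓ F).2.2.2.2.2.2.2.1,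
      (hJ F).1.2.2.2.1, (hJ F).1.2.2.2.2.1⟩,
    fun 𝔯 hpin => n16HolderAtReading_of_pinnedLoose β hpin fun F => ?_, hleaf,
    fun F => ⟨(hJ F).2.1, (hJ F).2.2.1, (hJ F).2.2.2.1, (hJ F).2.2.2.2.1, (hJ F).2.2.2.2.2.1, (hJ F).2.2.2.2.2.2⟩⟩
  · -- THE END's regime at the re-lettered constant layer (module 49 §1 transport of module 50 §2's `InEndRegimeH`; the regime does not read the data)
    have hreg := inEndRegimeH_reletter F _ (ne3DomOfRecord₁₁ F N 0 0) (hℓ F).2.2.2.2.2.2.2.2.1 (gradConst_four_pos (hs F).1) (hs F).1.le (hs F).2.2.2.1 le_rfl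
    exact hreg
  · -- the N16 conjunct: closer at radius `ε ∕ B₃` on the re-lettered loose object, then antitonicity down to radius `ε ∕ B`
    have hreg := inEndRegimeH_reletter F _ {V | V ∈ ne3DomOfRecord₁₁ F N 0 0 ∧ V ∈ sfClass 4 F.L (ne3NperOfRecord₁₁ F 0 0) ((ℓ F).ε / (C F).B₃) 0}
      (hℓ F).2.2.2.2.2.2.2.2.1 (gradConst_four_pos (hs F).1) (hs F).1.le (hs F).2.2.2.1 le_rfl
    have hH := n16HolderAt_of_inEndRegimeH_leafSlotHolderAT hreg hβ0 hβ1 (leafSlotHolderAT_reletter F _ _ _ _ (hℓ F).2.2.2.2.2.2.2.2.2)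
    have hres := n16HolderAt_anti_dom F (looseDom_anti F (hε0 F).le (C F).B₃_pos (hJ F).1.2.1) hH
    exact hres

/-! ## §3 ★★ The N16 → N19′ junction from `h5` + the slot key + node N07's two sentences only (§2 ∘ dag-n16-w4 p640452 §2) -/

/-- **★★ THE JUNCTION ROWS `hH3` ∧ `hsel` AT EVERY TUPLE, FROM `h5` + THE SLOT KEY + NODE N07's TWO SENTENCES.**  §2's letters `ℓ₃ B c'` and its first five conjuncts; then
for every top radius `εTop` with `(ℓ₃ F).ε ≤ εTop F`, every (P)-(8) at `(ρ F, εTop F)` on the pinned loose data `D_F` ([Balaban1985Variational] Thm 1 sentence 1 with clause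
(8) read at the problem level) and every Thm 1 sentence 2 at `εTop F` for interior local minimisers (dag-n16-w4 p640452 §2's binder texts VERBATIM at the PRODUCED radius
`ρ F := (C F).B₃·((ℓ₃ F).ε ∕ B F)`), and every reading `𝔯` pinned loose at `(ℓ₃, B)`: dag-n19-w3's rows `hH3` (`LeafH3sup 4 R.ne3.L R.ne3.Nper R.ne3.ε R.ne3.b (c' F)
R.ne3.dom`) and `hsel` (a selection of `R.ne3.ε`-minimisers, `RegularSup 4 R.ne3.L R.ne3.Nper R.ne3.b (c' F)`) at `R := rateCarriersOfRecord₁₃CoPH 𝔯 F θ hP g₀ os k`, every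
tuple and run length — p640452 §2's `hH3_of_pinnedLoose_of_loose_of_exists8P_locMin` ∕ `hsel_of_pinnedLoose_of_loose_of_exists8P` fed with §2's loose leaf and rows (`c F :=
16937·ρ F`).  No N16 letter row is displayed. [cite: Balaban1985Variational, Thm 1 (8)–(10) p.279] [folklore] -/
theorem exists_letters_hH3_hsel_of_h5_reg910Slot_of_exists8P_locMin
    (h5 : ∀ F : T4Family, letI : CStarAlgebra (Matrix (Fin N) (Fin N) ℂ) := {}
      ∃ (len : Site 4 → ℝ) (c₁ c₁' B₁' cP C₂ B₀β : ℝ) (inp : B8.B9Inputs),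
        (∀ v : Site 4, 0 < len v → 1 ≤ len v) ∧ (∀ μ : Fin 4, len (e μ) = 1) ∧ 0 < B₁' ∧ 5 * ((4 : ℕ) : ℝ) * F.L * inp.B₀ ≤ B₁' ∧ 0 < c₁' ∧
        (∀ α₀ α₁ : ℝ, 0 < α₀ → 0 < α₁ → α₀ + α₁ ≤ c₁' →
          α₀ + α₁ ≤ c₁ ∧ C0 4 * (2 * α₀) ≤ 1 / 3 ∧ 4 * α₀ ≤ c2' 4 F.L ∧ 16 * (B₁' * (α₀ + α₁)) ≤ 1 ∧
          Real.exp (4 * (800 * (((4 : ℕ) : ℝ) + 1) ^ 2 * (((4 : ℕ) : ℝ) + 4)) * α₀) * (1 + 8 * (131072 * (((4 : ℕ) : ℝ) + 1) ^ 2) * (B₁' * (α₀ + α₁))) ≤ 2 ∧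
          2 * (B₁' * (α₀ + α₁)) ≤ c3 4 F.L ∧ ((4 : ℕ) : ℝ) * F.L * α₁ ≤ 1 / 8 ∧ α₀ ≤ cP ∧ α₁ ≤ cP ∧ B₁' * (α₀ + α₁) ≤ cP ∧
          2 * (B₁' * (α₀ + α₁)) ^ 2 + 20 * ((4 : ℕ) : ℝ) * α₀ * (B₁' * (α₀ + α₁)) + 2 * C₂ * (B₁' * (α₀ + α₁)) ^ 2 ≤ α₀ + α₁) ∧
        B8.Thm4Body c₁ B₁' (fun i : {i : ZdIdx 4 F.L // (∀ j, i.Ω j = Set.univ) ∧ (∀ m j, i.Λs m j = {_y | j = m}) ∧ (∀ m j, i.Λb m j = {_c | j = m}) ∧ i.η = ((F.L : ℝ)⁻¹) ^ i.k} => (zdGF3 (Matrix (Fin N) (Fin N) ℂ) F.L β len i.1).toGFData) ∧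
        B8.Prop3Body cP 4 (F.L : ℝ) C₂ inp B₀β (fun i : {i : ZdIdx 4 F.L // (∀ j, i.Ω j = Set.univ) ∧ (∀ m j, i.Λs m j = {_y | j = m}) ∧ (∀ m j, i.Λb m j = {_c | j = m}) ∧ i.η = ((F.L : ℝ)⁻¹) ^ i.k} => (zdGF3 (Matrix (Fin N) (Fin N) ℂ) F.L β len i.1).toGFData2))
    {G : T4Family → (Site 4 → Fin 4 → (MatA N)ˣ) → Site 4 → ℕ → ℝ → ℝ → ℝ → Prop} (hGm : ∀ F, RadiiMono 4 (G F))
    (hG : ∀ (F : T4Family) (U : Site 4 → Fin 4 → (MatA N)ˣ) (x : Site 4) (K : ℕ) (α₀ α₁ α₂ : ℝ), 2 ≤ K → G F U x K α₀ α₁ α₂ →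
      ∃ (u : Site 4 → (MatA N)ˣ) (a : Site 4 → Fin 4 → MatA N),
        (∀ z, u z ∈ unitaryUnits (MatA N)) ∧
        (∀ (y : Site 4) (τ : Fin 4), l1 (y - x) ≤ 2 → ((gaugeAct u U y τ : (MatA N)ˣ) : MatA N) = exp (a y τ)) ∧
        (∀ (y : Site 4) (τ : Fin 4), l1 (y - x) ≤ 2 → ‖a y τ‖ ≤ α₀) ∧
        (∀ (y : Site 4) (τ i : Fin 4), l1 (y - x) ≤ 1 → ‖fd i (fun z => a z τ) y‖ ≤ α₁) ∧
        (∀ (τ i l : Fin 4), ‖fd i (fd l (fun z => a z τ)) x‖ ≤ α₂))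
    (C : T4Family → B11Thm1.Consts)
    (hR : ∀ (F : T4Family) (k : ℕ) (ε₁ : ℝ), 0 < ε₁ → ε₁ ≤ (C F).a₁ → ∀ (V U : Site 4 → Fin 4 → (MatA N)ˣ), V ∈ sfClass 4 F.L (ne3NperOfRecord₁₁ F 0 0) ε₁ 0 →
      IsMinimiser 4 (sfClass 4 F.L (ne3NperOfRecord₁₁ F 0 0) ((C F).B₃ * ε₁)) F.L (ne3NperOfRecord₁₁ F 0 0) (k + 1) V U →
        ∀ x : Site 4, Regularity (torusVP 4 F.L (ne3NperOfRecord₁₁ F 0 0) (G F) (k + 1)) (C F).B₃ (C F).B₄ ε₁ U (x, F.L ^ (k + 1) - 1 + F.L ^ (k + 1) + 2)) :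
    ∃ (ℓ₃ : T4Family → NE3Letters₁₁) (B c' : T4Family → ℝ), N16LettersEnd N (fun F => gradConst 4 (c' F)) ℓ₃ ∧
      (∀ F : T4Family, 0 < B F ∧ (ℓ₃ F).ε / B F ≤ (ℓ₃ F).b) ∧
      (∀ F : T4Family, (C F).B₃ ≤ B F ∧ (2 : ℝ) ^ 78 * (F.L : ℝ) ^ 12 ≤ B F) ∧
      (∀ F : T4Family, (ℓ₃ F).g = gradConst 4 (c' F) ∧ 0 ≤ c' F ∧ 0 < c' F ∧ (ℓ₃ F).b ≤ c' F ∧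
        (2 : ℝ) ^ 91 * (F.L : ℝ) ^ 17 * c' F ≤ 1 ∧ (2 : ℝ) ^ 76 * (F.L : ℝ) ^ 12 * c' F ≤ (ℓ₃ F).ε ∧
        16 * C0 4 * (ℓ₃ F).ε ≤ 3 ∧ 1024 * (4 + 1) * (4 + 4) * (F.L : ℝ) ^ 2 * (ℓ₃ F).ε ≤ 1 ∧
        (ℓ₃ F).ε / B F ≤ 1 / 4 ∧ 4 * ((ℓ₃ F).ε / B F) ≤ c' F) ∧
      (∀ 𝔯 : RateReading₁₃CoPH N, N16PinnedLoose 𝔯 ℓ₃ B → N16HolderAtReading 𝔯 β) ∧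
      ∀ εTop : T4Family → ℝ, (∀ F : T4Family, (ℓ₃ F).ε ≤ εTop F) →
        (∀ (F : T4Family), ∀ V ∈ ({V | V ∈ ne3DomOfRecord₁₁ F N 0 0 ∧ V ∈ sfClass 4 F.L (ne3NperOfRecord₁₁ F 0 0) ((ℓ₃ F).ε / B F) 0} :
            Set (Site 4 → Fin 4 → (MatA N)ˣ)), ∀ k : ℕ, ∃ U₀ : Site 4 → Fin 4 → (MatA N)ˣ,
          U₀ ∈ sfClass 4 F.L (ne3NperOfRecord₁₁ F 0 0) ((C F).B₃ * ((ℓ₃ F).ε / B F)) (k + 1) ∧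
            IsMinimiser 4 (sfClass 4 F.L (ne3NperOfRecord₁₁ F 0 0) (εTop F)) F.L (ne3NperOfRecord₁₁ F 0 0) (k + 1) V U₀) →
        (∀ (F : T4Family) (k : ℕ), ∀ V ∈ ({V | V ∈ ne3DomOfRecord₁₁ F N 0 0 ∧ V ∈ sfClass 4 F.L (ne3NperOfRecord₁₁ F 0 0) ((ℓ₃ F).ε / B F) 0} :
            Set (Site 4 → Fin 4 → (MatA N)ˣ)),
          ∀ U₀ : Site 4 → Fin 4 → (MatA N)ˣ,
            IsMinimiser 4 (sfClass 4 F.L (ne3NperOfRecord₁₁ F 0 0) ((C F).B₃ * ((ℓ₃ F).ε / B F))) F.L (ne3NperOfRecord₁₁ F 0 0) (k + 1) V U₀ →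
          ∀ U : Site 4 → Fin 4 → (MatA N)ˣ, U ∈ sfClass 4 F.L (ne3NperOfRecord₁₁ F 0 0) (εTop F) (k + 1) → avgIter F.L U (k + 1) = V →
            U ∈ sfClass 4 F.L (ne3NperOfRecord₁₁ F 0 0) (ℓ₃ F).ε (k + 1) →
            IsLocalMinOn (fun W : Site 4 → Fin 4 → (MatA N)ˣ => levelAction 4 F.L (ne3NperOfRecord₁₁ F 0 0) (k + 1) W)
              (admissible (sfClass 4 F.L (ne3NperOfRecord₁₁ F 0 0) (εTop F)) F.L (k + 1) V) U →
            ∃ u : Site 4 → (MatA N)ˣ, IsUnitarySite u ∧ IsPeriodicSite u ((ne3NperOfRecord₁₁ F 0 0 * F.L ^ (k + 1) : ℕ) : ℤ) ∧ gaugeAct u U₀ = U) →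
        ∀ 𝔯 : RateReading₁₃CoPH N, N16PinnedLoose 𝔯 ℓ₃ B →
          (∀ (F : T4Family) (θ : Stage13HParams F N) (hP : θ.Provisos₁₃CoPH F N) (g₀ : ℕ → ℝ) (os : List (ULoop F)) (k : ℕ),
            LeafH3sup 4 (rateCarriersOfRecord₁₃CoPH 𝔯 F θ hP g₀ os k).ne3.L (rateCarriersOfRecord₁₃CoPH 𝔯 F θ hP g₀ os k).ne3.Nper
              (rateCarriersOfRecord₁₃CoPH 𝔯 F θ hP g₀ os k).ne3.ε (rateCarriersOfRecord₁₃CoPH 𝔯 F θ hP g₀ os k).ne3.b (c' F)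
              (rateCarriersOfRecord₁₃CoPH 𝔯 F θ hP g₀ os k).ne3.dom) ∧
          (∀ (F : T4Family) (θ : Stage13HParams F N) (hP : θ.Provisos₁₃CoPH F N) (g₀ : ℕ → ℝ) (os : List (ULoop F)) (k : ℕ),
            ∃ sel : ℕ → (Site 4 → Fin 4 → (MatA N)ˣ) → (Site 4 → Fin 4 → (MatA N)ˣ),
              (∀ V ∈ (rateCarriersOfRecord₁₃CoPH 𝔯 F θ hP g₀ os k).ne3.dom, ∀ j : ℕ,
                IsMinimiser 4 (sfClass 4 (rateCarriersOfRecord₁₃CoPH 𝔯 F θ hP g₀ os k).ne3.L (rateCarriersOfRecord₁₃CoPH 𝔯 F θ hP g₀ os k).ne3.Nper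
                  (rateCarriersOfRecord₁₃CoPH 𝔯 F θ hP g₀ os k).ne3.ε) (rateCarriersOfRecord₁₃CoPH 𝔯 F θ hP g₀ os k).ne3.L
                  (rateCarriersOfRecord₁₃CoPH 𝔯 F θ hP g₀ os k).ne3.Nper j V (sel j V)) ∧
              (∀ V ∈ (rateCarriersOfRecord₁₃CoPH 𝔯 F θ hP g₀ os k).ne3.dom, ∀ j : ℕ,
                RegularSup 4 (rateCarriersOfRecord₁₃CoPH 𝔯 F θ hP g₀ os k).ne3.L (rateCarriersOfRecord₁₃CoPH 𝔯 F θ hP g₀ os k).ne3.Nper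
                  (rateCarriersOfRecord₁₃CoPH 𝔯 F θ hP g₀ os k).ne3.b (c' F) j (sel j V))) := by
  obtain ⟨ℓ₃, B, c', hEnd, hM, hF, hrows, hH, hloose, hJ⟩ :=
    exists_letters_n16HolderAtReading_loose_squeezeJunction_of_h5_reg910Slot (N := N) hβ0 hβ1 h5 hGm hG C hR
  refine ⟨ℓ₃, B, c', hEnd, hM, hF, hrows, hH, fun εTop hεT h8P hU6loc 𝔯 hpin => ⟨?_, ?_⟩⟩
  · exact hH3_of_pinnedLoose_of_loose_of_exists8P_locMin (ρ := fun F => (C F).B₃ * ((ℓ₃ F).ε / B F))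
      (c := fun F => 16937 * ((C F).B₃ * ((ℓ₃ F).ε / B F))) hpin hloose (fun F => (hJ F).2.1) hεT h8P hU6loc
      (fun F => (hJ F).2.2.1) (fun F => (hJ F).2.2.2.1)
  · exact hsel_of_pinnedLoose_of_loose_of_exists8P (ρ := fun F => (C F).B₃ * ((ℓ₃ F).ε / B F))
      (c := fun F => 16937 * ((C F).B₃ * ((ℓ₃ F).ε / B F))) hpin hloose (fun F => (hJ F).2.1) hεT h8P
      (fun F => (hJ F).2.2.1) (fun F => (hJ F).2.2.2.1) hM
      (fun F => ⟨(hrows F).1, (hrows F).2.1, (hrows F).2.2.1, (hrows F).2.2.2.1, (hrows F).2.2.2.2.1, (hrows F).2.2.2.2.2.1,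
        (hrows F).2.2.2.2.2.2.2.2.1, (hrows F).2.2.2.2.2.2.2.2.2⟩)

end Producer

end

end Summit.QuantumFields.YangMills.BalabanUVNodes.N16PinnedLooseMatchSqueezeJunction
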